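import Literature.Probability.Percolation.MarkedLoopHolomorphy
import Literature.Probability.Percolation.MarkedLoopBoundarySupport
import HarnessLib

/-!
# Boundary values of the fan observable: support on three arcs and the single-term boundary law

Topic `Literature/Probability/Percolation`; generic-`k` layer of the three-disorder lineage (Khristoforov–Smirnov 2021), sequel to
`MarkedLoopHolomorphy.lean` (the FAN observable `fanWt l`: weight `−(−τ²)^m` on the fan pattern `P_m` with apex `m ≤ l`, discretely
holomorphic on every `(2l+1)`-marked domain) and `MarkedLoopBoundarySupport.lean` (no strand of a boundary mid-edge is separated from its
partner by another strand: `false_of_interleaved_link`).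

* `false_of_chord_separates` — at a boundary mid-edge `z ∈ A_a` (read at a face with three `H_G`-sides, odd endpoint not a corner), if `z` is
  linked to `u_m` and `u_c ~ u_d`, then the chord `{c, d}` does not separate `z` from `u_m` (`(c, d, m)` anticlockwise with `a` on the arc
  from `c` to `d` is impossible) — a 3-marked re-marking at `(c, d, m)` (the tree's `exists_remark₃`) + `false_of_interleaved_link`.
* ★ `fan_boundary_support` — a configuration at `z ∈ A_a` linked to `u_m` (`m ≤ l`) with the fan links `P_m` has `a ∈ {m − 1, m, 2l − m}`:
  the inner chord `{m+1, 2l−m}` and the outer chord `{m−1, 2l+1−m}` of the fan fence the apex.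
* `fanWt_eq_zero_of_boundary` — hence the fan weight of a boundary configuration vanishes off those three arcs.
* ★★ `gkW_fan_boundary`, `obsW_fan_boundary` — THE SINGLE-TERM BOUNDARY LAW: for `l ≤ a` the only apex seen from `A_a` is `m = 2l − a`,
  so every configuration at `z ∈ A_a` weighs `0` or the fixed phase `−(−τ²)^{2l−a}`, and `ObsW (fanWt l) v i = −(−τ²)^{2l−a} · N` with
  `N ∈ ℕ` the number of configurations (both halves) linking `z` to `u_{2l−a}` with the fan links — the `k`-mark analogue of
  Khristoforov–Smirnov's boundary values eq. (4) (`F(z) ∈ [τ^{j−1}, τ^{j+1}]` on `∂_jΩ`, p. 5), here with ONE endpoint: on the arcs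
  `A_l, …, A_{2l}` the fan observable has a prescribed ARGUMENT.
* ★★ `gkW_fan_boundary_two`, `obsW_fan_boundary_two` — THE TWO-TERM BOUNDARY LAW: for `a < l` (the apex side) every configuration at `z ∈ A_a` weighs `0`,
  `−(−τ²)^a` or `−(−τ²)^{a+1}`, so `ObsW (fanWt l) v i = −(−τ²)^a (N_a + (−τ²) N_{a+1})` lies in a fixed sector of opening `π/3` —
  together with the single-term law a complete discrete Riemann–Hilbert boundary datum for the fan observable.

Status in print: eq. (4) is printed at `k = 3`; the fan observable and its boundary law for `k ≥ 5` are the lane's (first kernel text),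
the planar input being the tree's boundary-support machinery. No boundary-value PROBLEM (uniqueness / continuum) is claimed.

## Editions / sequels (provenance)
* ed.1 → ed.3 (HOME editions of 2026-08-24; ed.3 = the landed text, p376640); ed.4 (this edition): this «Editions / sequels» paragraph
  only — no declaration changed.
* Sequels in the lane's kernel texts: `MarkedLoopTripodBasis` («TRIPOD-SOLVED», Part BASIS-BVP) generalises `false_of_chord_separates`
  to THE ARC LAW for every tripod-law observable (`encl_iff_encl_gap_of_boundary`: a linked pair of other corners encloses the partner iff it
  encloses the mid-edge) and identifies the fan as `−basisW (rainbow l)` (`restrictW_fanWt_eq_neg_basisW`), so the single-term law above is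
  the home-arc case of `obsW_basis_boundary_last`; `MarkedLoopRotation` (p379007) makes the `k` ROTATED fans theorems
  (`holomorphicW_rotW_fanWt`); `MarkedLoopTripodCuts` gives the count law on every arc for the basis adapted to that arc
  (`obsW_basisWAt_boundary`). The lane's numerical probe (2026-08-24) records that no non-constant solution at `k = 5, 7` has boundary
  coefficient sets on a LINE on all arcs — the scalar Riemann–Hilbert reading of the two laws above is special to the fan's own arcs.

## References
* M. Khristoforov, S. Smirnov, *Percolation and O(1) loop model*, arXiv:2111.15612 (2021), §1.2 (arXiv v1 p. 2), §2 Definition 3 (p. 4),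
  eq. (4) and Remark 6 (p. 5).
* B. Bollobás, O. Riordan, *Percolation*, Cambridge University Press (2006), Ch. 7 §7.2.2 (pp. 191–195), §7.2.3 p. 197.

## Mathlib / tree
Tree: `MarkedLoopBoundarySupport.lean` (`exists_remark₃`, `false_of_interleaved_link`, `pos_facts_of_mem_stretch`, `lt_pos_of_lt`,
`pos_le_of_le`, `iter_add_mul_card`), `KhSThreeDisorderBoundaryValuesArcs.lean` (`stretchIdx₃_of_mem_stretch`),
`MarkedLoopHolomorphy.lean` (`CcwTriple`, `fanRel`, `fanWt`, `mem_fanRel`, `fanWt_ne_zero_iff`, `fanWt_eq_zero_of_lt`, `fanWt_eq_of_eq`,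
`linkRel`, `mem_linkRel`, `GkW`, `ObsW`), `KhSThreeDisorderObservable.lean` (`TXb`, `InClassX`, `AllSides`), `MarkedLoopSpace.lean`
(`corners`, `yc`, `eq_yc`). Mathlib: `Fin.strictMono_iff_lt_succ`.
-/

open Finset

namespace Literature.Probability.Percolation.MarkedLoops

open Literature.Probability.Percolation Literature.Probability.LatticeModels
open Literature.Probability.Percolation.FivePoint (side xiDeg XiLinked Inc inc_side oppFace_injective' tau)
open Literature.Probability.Percolation.FivePoint.N5 (sideGraph side_oppFace_oppIdx xiLinked_iff_reachable coreCompl coreEnd)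
open TriMarkedDomain

/-! # FAN BOUNDARY VALUES: on the boundary arc `A_a` the fan observable keeps at most the apexes `m` with `a ∈ {m − 1, m, 2l − m}`

Topic `Literature/Probability/Percolation`; generic-`k` layer. For a boundary mid-edge `z` of the arc `A_a` of a `(2l+1)`-marked domain (read
at a face with three `H_G`-sides, odd endpoint `s` not a corner), a configuration of `W_Ω(u₀,…,u_{2l}, z)` whose link pattern is the FAN
PATTERN `P_m` (partner `u_m`, the other corners matched by `fanRel l m`) forces `a = m − 1`, `a = m` or `a = 2l − m`: the chord from `z` to
`u_m` must stay inside the face of the fan matching that contains the apex. Planar input = the tree's `false_of_interleaved_link`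
(`MarkedLoopBoundarySupport.lean`: no strand of `z` is separated from its partner by another strand; a 3-marked re-marking + the `k = 3`
boundary-value theorem). Consequence (`fanWt_eq_zero_of_boundary`): the fan weight of such a configuration vanishes unless
`a ∈ {m − 1, m, 2l − m}`; on the arcs `l + 1 ≤ a ≤ 2l − 1` a SINGLE apex `m = 2l − a` survives, so there the fan observable is a
configuration count times the fixed phase `−(−τ²)^{2l−a}` — the `k`-mark analogue of Khristoforov–Smirnov's boundary values eq. (4)
(`F(z) ∈ [τ^{j−1}, τ^{j+1}]` on `∂_jΩ`, p. 5). -/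

section ChordCross

variable {nm : ℕ} {D : TriMarkedDomain nm}

/-- **no strand of a boundary mid-edge crosses a chord**: if `z ∈ A_a` (bond `side v i = s(g,o)`, `(g,o) ∈ D.stretch a`) is linked to
`u_m` and the corners `u_c ~ u_d` are linked, then `(c, d, m)` is NOT an anticlockwise triple with `a` on the arc from `c` to `d`
(i.e. the chord `{c, d}` does not separate `z` from `u_m`). [cite: KhristoforovSmirnov2021, §1.2 (arXiv v1 p. 2) and §2 eq. (4) (p. 5)] -/
theorem false_of_chord_separates {v : HexVertex} (hv : AllSides D v) {i : Fin 3} {s : HexVertex}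
    (hs : s ∈ ({v, oppFace v i} : Finset HexVertex)) (hsc : s ∉ corners D) {g o : Site 2} (he : side v i = s(g, o))
    {a : Fin nm} (hd : (g, o) ∈ D.stretch a) {ξ : Finset (Sym2 (Site 2))} (hξ : ξ ∈ TXb D v i s)
    {c d m : Fin nm} (hcdm : CcwTriple c d m) (ha : (c ≤ a ∧ a < d) ∨ (d < c ∧ (c ≤ a ∨ a < d)))
    (hm : XiLinked ξ s (yc D m)) (hcd : XiLinked ξ (yc D c) (yc D d)) : False := by
  classical
  obtain ⟨hpa, hnext, hL0, hiter, hmem⟩ := pos_facts_of_mem_stretch hd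
  obtain ⟨hg, ho, -⟩ := mem_triBdryDarts.1 hmem
  set P := #(triBdryDarts D.verts) with hP
  set n₀ := D.dpos (g, o) with hn₀
  have hPpos : 0 < P := lt_of_le_of_lt (Nat.zero_le _) hL0
  have hposlt : ∀ x : Fin nm, D.pos x < P := fun x => D.pos_lt x
  -- distinct corners
  have key : ∀ {x y z : Fin nm}, CcwTriple x y z → x ≠ y ∧ y ≠ z ∧ x ≠ z := by
    intro x y z hx
    unfold CcwTriple at hx
    refine ⟨?_, ?_, ?_⟩ <;> rintro rfl
    · rcases hx with ⟨h, -⟩ | ⟨h, h'⟩ | ⟨-, h⟩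
      · exact lt_irrefl _ h
      · exact lt_irrefl _ (h.trans h')
      · exact lt_irrefl _ h
    · rcases hx with ⟨-, h⟩ | ⟨h, -⟩ | ⟨h, h'⟩
      · exact lt_irrefl _ h
      · exact lt_irrefl _ h
      · exact lt_irrefl _ (h.trans h')
    · rcases hx with ⟨h, h'⟩ | ⟨-, h⟩ | ⟨h, -⟩
      · exact lt_irrefl _ (h.trans h')
      · exact lt_irrefl _ h
      · exact lt_irrefl _ h
  obtain ⟨ncd, ndm, ncm⟩ := key hcdm
  have v0 : (![c, d, m] : Fin 3 → Fin nm) 0 = c := rfl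
  have v1 : (![c, d, m] : Fin 3 → Fin nm) 1 = d := rfl
  have v2 : (![c, d, m] : Fin 3 → Fin nm) 2 = m := rfl
  have hinj3 : Function.Injective ![c, d, m] := by
    intro t t' h
    have e3 : ∀ t : Fin 3, t = 0 ∨ t = 1 ∨ t = 2 := by decide
    rcases e3 t with rfl | rfl | rfl <;> rcases e3 t' with rfl | rfl | rfl
    · rfl
    · rw [v0, v1] at h; exact absurd h ncd
    · rw [v0, v2] at h; exact absurd h ncm
    · rw [v1, v0] at h; exact absurd h.symm ncd
    · rfl
    · rw [v1, v2] at h; exact absurd h ndm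
    · rw [v2, v0] at h; exact absurd h.symm ncm
    · rw [v2, v1] at h; exact absurd h.symm ndm
    · rfl
  -- the lifted positions `mm t = pos (![c,d,m] t) + q t * P`, strictly increasing within one period from `pos c`
  -- case analysis on the rotation
  have build : ∃ mm : Fin 3 → ℕ, StrictMono mm ∧ (∀ t, mm t < mm 0 + P) ∧
      (∀ t, ∃ q : ℕ, mm t = D.pos (![c, d, m] t) + q * P) ∧ mm 0 = D.pos c ∧
      (mm 1 = D.pos d ∨ mm 1 = D.pos d + P) := by
    unfold CcwTriple at hcdm
    rcases hcdm with ⟨h1, h2⟩ | ⟨h1, h2⟩ | ⟨h1, h2⟩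
    · -- c < d < m
      refine ⟨![D.pos c, D.pos d, D.pos m], ?_, ?_, ?_, rfl, Or.inl rfl⟩
      · refine Fin.strictMono_iff_lt_succ.2 fun t => ?_
        fin_cases t
        · exact D.pos_strictMono h1
        · exact D.pos_strictMono h2
      · intro t; fin_cases t
        · show D.pos c < D.pos c + P; omega
        · show D.pos d < D.pos c + P; have := hposlt d; omega
        · show D.pos m < D.pos c + P; have := hposlt m; omega
      · intro t; fin_cases t
        · exact ⟨0, by simp⟩
        · exact ⟨0, by simp⟩
        · exact ⟨0, by simp⟩
    · -- d < m < c
      refine ⟨![D.pos c, D.pos d + P, D.pos m + P], ?_, ?_, ?_, rfl, Or.inr rfl⟩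
      · refine Fin.strictMono_iff_lt_succ.2 fun t => ?_
        fin_cases t
        · show D.pos c < D.pos d + P; have := hposlt c; omega
        · show D.pos d + P < D.pos m + P; have := D.pos_strictMono h1; omega
      · intro t; fin_cases t
        · show D.pos c < D.pos c + P; omega
        · show D.pos d + P < D.pos c + P; have := D.pos_strictMono (h1.trans h2); omega
        · show D.pos m + P < D.pos c + P; have := D.pos_strictMono h2; omega
      · intro t; fin_cases t
        · exact ⟨0, by simp⟩
        · exact ⟨1, by simp⟩
        · exact ⟨1, by simp⟩
    · -- m < c < d
      refine ⟨![D.pos c, D.pos d, D.pos m + P], ?_, ?_, ?_, rfl, Or.inl rfl⟩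
      · refine Fin.strictMono_iff_lt_succ.2 fun t => ?_
        fin_cases t
        · exact D.pos_strictMono h2
        · show D.pos d < D.pos m + P; have := hposlt d; omega
      · intro t; fin_cases t
        · show D.pos c < D.pos c + P; omega
        · show D.pos d < D.pos c + P; have := hposlt d; omega
        · show D.pos m + P < D.pos c + P; have := D.pos_strictMono h1; omega
      · intro t; fin_cases t
        · exact ⟨0, by simp⟩
        · exact ⟨0, by simp⟩
        · exact ⟨1, by simp⟩
  obtain ⟨mm, hmono, hLt, hq, hm0, hm1⟩ := build
  obtain ⟨D₃, hV, hyc, hst0⟩ := exists_remark₃ D ![c, d, m] mm hmono hLt hq hinj3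
  have hy0 : yc D₃ 0 = yc D c := by rw [hyc]; rfl
  have hy1 : yc D₃ 1 = yc D d := by rw [hyc]; rfl
  have hy2 : yc D₃ 2 = yc D m := by rw [hyc]; rfl
  -- the dart of `z` lies on the first stretch of `D₃`
  have hn₀P : n₀ < P := hL0
  have hnpos : D.pos a ≤ n₀ := hpa
  have hzst : (g, o) ∈ D₃.stretch 0 := by
    -- choose the representative of `n₀` in `[mm 0, mm 1)`
    have hcases : (mm 0 ≤ n₀ ∧ n₀ < mm 1) ∨ (mm 0 ≤ n₀ + P ∧ n₀ + P < mm 1) := by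
      rw [hm0]
      rcases ha with ⟨hca, had⟩ | ⟨hdc, hca | had⟩
      · left
        refine ⟨le_trans (pos_le_of_le hnpos hca) le_rfl, ?_⟩
        have : n₀ < D.pos d := lt_pos_of_lt hnext had
        rcases hm1 with h | h <;> rw [h] <;> omega
      · left
        refine ⟨pos_le_of_le hnpos hca, ?_⟩
        rcases hm1 with h | h
        · -- mm 1 = pos d < pos c ≤ n₀: impossible with StrictMono unless wrapped; here mm 1 = pos d + P
          exfalso
          have := hmono (show (0 : Fin 3) < 1 by decide)
          rw [hm0, h] at this
          exact absurd (D.pos_strictMono hdc) (not_lt.2 this.le)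
        · rw [h]; omega
      · right
        refine ⟨?_, ?_⟩
        · have := hposlt c; omega
        · have : n₀ < D.pos d := lt_pos_of_lt hnext had
          rcases hm1 with h | h
          · exfalso
            have := hmono (show (0 : Fin 3) < 1 by decide)
            rw [hm0, h] at this
            exact absurd (D.pos_strictMono hdc) (not_lt.2 this.le)
          · rw [h]; omega
    rcases hcases with ⟨h1, h2⟩ | ⟨h1, h2⟩
    · have := hst0 n₀ h1 h2
      rwa [hiter] at this
    · have := hst0 (n₀ + P) h1 h2
      rwa [show n₀ + P = n₀ + 1 * P by ring, iter_add_mul_card, hiter] at this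
  have hst : D₃.stretchIdx₃ (D₃.dpos (g, o)) = 0 := stretchIdx₃_of_mem_stretch D₃ hzst
  have hC : ∀ t : Fin 3, yc D₃ t ∈ corners D := fun t => by rw [hyc]; exact yc_mem_corners D _
  exact false_of_interleaved_link D₃ hV hC hv hs hsc he hg ho hst hξ (by rw [hy2]; exact hm) (by rw [hy0, hy1]; exact hcd)

end ChordCross

section FanBoundary

variable {l : ℕ} {D : TriMarkedDomain (2 * l + 1)}

/-- ★★ **FAN BOUNDARY SUPPORT**: at a boundary mid-edge `z ∈ A_a`, a configuration linked to `u_m` (`m ≤ l`) whose links among the corners are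
the fan `P_m` has `a = m − 1`, `a = m` or `a = 2l − m`. [cite: KhristoforovSmirnov2021, §2 eq. (4) (arXiv v1 p. 5: boundary values); §1.2 (p. 2)] -/
theorem fan_boundary_support {v : HexVertex} (hv : AllSides D v) {i : Fin 3} {s : HexVertex}
    (hs : s ∈ ({v, oppFace v i} : Finset HexVertex)) (hsc : s ∉ corners D) {g o : Site 2} (he : side v i = s(g, o))
    {a : Fin (2 * l + 1)} (hd : (g, o) ∈ D.stretch a) {ξ : Finset (Sym2 (Site 2))} (hξ : ξ ∈ TXb D v i s)
    {m : Fin (2 * l + 1)} (hml : m.val ≤ l) (hm : XiLinked ξ s (yc D m)) (hfan : linkRel D ξ = fanRel l m.val) :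
    a.val + 1 = m.val ∨ a = m ∨ a.val = 2 * l - m.val := by
  classical
  by_contra hnot
  have h1 : a.val + 1 ≠ m.val := fun h => hnot (Or.inl h)
  have h2 : a ≠ m := fun h => hnot (Or.inr (Or.inl h))
  have h3 : a.val ≠ 2 * l - m.val := fun h => hnot (Or.inr (Or.inr h))
  have ha := a.isLt
  have h2' : a.val ≠ m.val := fun e => h2 (Fin.ext e)
  -- a linked pair of the fan gives linked corner faces
  have linked : ∀ (c d : Fin (2 * l + 1)), (c, d) ∈ fanRel l m.val → XiLinked ξ (yc D c) (yc D d) := by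
    intro c d h
    rw [← hfan, mem_linkRel] at h
    exact h.2
  by_cases hlow : a.val + 2 ≤ m.val
  · -- outer chord {m−1, 2l+1−m}: `a` outside, `m` inside
    have q1 : m.val - 1 < 2 * l + 1 := by omega
    have q2 : 2 * l + 1 - m.val < 2 * l + 1 := by omega
    have hq : ((⟨2 * l + 1 - m.val, q2⟩ : Fin _), (⟨m.val - 1, q1⟩ : Fin _)) ∈ fanRel l m.val := by
      rw [mem_fanRel]; left; simp only; omega
    refine false_of_chord_separates hv hs hsc he hd hξ (c := ⟨2 * l + 1 - m.val, q2⟩) (d := ⟨m.val - 1, q1⟩) (m := m)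
      ?_ ?_ hm (linked _ _ hq)
    · unfold CcwTriple; right; left
      exact ⟨Fin.lt_def.2 (by simp only; omega), Fin.lt_def.2 (by simp only; omega)⟩
    · right
      refine ⟨Fin.lt_def.2 (by simp only; omega), Or.inr (Fin.lt_def.2 (by simp only; omega))⟩
  by_cases hmid : m.val + 1 ≤ a.val ∧ a.val + 1 ≤ 2 * l - m.val
  · -- inner chord {m+1, 2l−m}: `a` inside, `m` outside
    have q1 : m.val + 1 < 2 * l + 1 := by omega
    have q2 : 2 * l - m.val < 2 * l + 1 := by omega
    have hq : ((⟨m.val + 1, q1⟩ : Fin _), (⟨2 * l - m.val, q2⟩ : Fin _)) ∈ fanRel l m.val := by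
      rw [mem_fanRel]; right; simp only; omega
    refine false_of_chord_separates hv hs hsc he hd hξ (c := ⟨m.val + 1, q1⟩) (d := ⟨2 * l - m.val, q2⟩) (m := m)
      ?_ ?_ hm (linked _ _ hq)
    · unfold CcwTriple; right; right
      exact ⟨Fin.lt_def.2 (by simp only; omega), Fin.lt_def.2 (by simp only; omega)⟩
    · left
      exact ⟨Fin.le_def.2 (by simp only; omega), Fin.lt_def.2 (by simp only; omega)⟩
  · -- remaining: a ≥ 2l − m + 1 (and a ≠ 2l − m, a ≠ m − 1, a ≠ m): outer chord again, `a` on the far side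
    have hge : 2 * l - m.val + 1 ≤ a.val := by omega
    have hm1 : 1 ≤ m.val := by omega
    have q1 : m.val - 1 < 2 * l + 1 := by omega
    have q2 : 2 * l + 1 - m.val < 2 * l + 1 := by omega
    have hq : ((⟨2 * l + 1 - m.val, q2⟩ : Fin _), (⟨m.val - 1, q1⟩ : Fin _)) ∈ fanRel l m.val := by
      rw [mem_fanRel]; left; simp only; omega
    refine false_of_chord_separates hv hs hsc he hd hξ (c := ⟨2 * l + 1 - m.val, q2⟩) (d := ⟨m.val - 1, q1⟩) (m := m)
      ?_ ?_ hm (linked _ _ hq)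
    · unfold CcwTriple; right; left
      exact ⟨Fin.lt_def.2 (by simp only; omega), Fin.lt_def.2 (by simp only; omega)⟩
    · right
      exact ⟨Fin.lt_def.2 (by simp only; omega), Or.inl (Fin.le_def.2 (by simp only; omega))⟩

/-- ★ **the fan weight of a boundary configuration vanishes off the three arcs of its apex.**
[cite: KhristoforovSmirnov2021, §2 eq. (4) (arXiv v1 p. 5); Definition 3 (p. 4)] -/
theorem fanWt_eq_zero_of_boundary {v : HexVertex} (hv : AllSides D v) {i : Fin 3} {s : HexVertex}
    (hs : s ∈ ({v, oppFace v i} : Finset HexVertex)) (hsc : s ∉ corners D) {g o : Site 2} (he : side v i = s(g, o))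
    {a : Fin (2 * l + 1)} (hd : (g, o) ∈ D.stretch a) {ξ : Finset (Sym2 (Site 2))} (hξ : ξ ∈ TXb D v i s)
    {m : Fin (2 * l + 1)} (hm : InClassX D (faceVertex v (i + 1)) (faceVertex v (i + 2)) s m ξ)
    (ha : a.val + 1 ≠ m.val ∧ a ≠ m ∧ a.val ≠ 2 * l - m.val) : fanWt l m (linkRel D ξ) = 0 := by
  classical
  by_contra hne
  obtain ⟨hml, hfan⟩ := fanWt_ne_zero_iff hne
  obtain ⟨-, Y, hY, hlink⟩ := hm
  rw [eq_yc D hY] at hlink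
  rcases fan_boundary_support hv hs hsc he hd hξ hml hlink hfan with h | h | h
  · exact ha.1 h
  · exact ha.2.1 h
  · exact ha.2.2 h

/-- Auxiliary: `2l − a` as a mark index. [folklore] -/
private theorem twoL_sub_lt (a : Fin (2 * l + 1)) : 2 * l - a.val < 2 * l + 1 := by omega

open Classical in
/-- ★★ **THE SINGLE-TERM BOUNDARY LAW OF THE FAN OBSERVABLE**: at a boundary mid-edge `z ∈ A_a` with `l ≤ a` (the arcs opposite to the apex
side of the fan), the weight of EVERY configuration is either `0` or the fixed phase `−(−τ²)^{2l−a}`, according as the configuration links `z` to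
`u_{2l−a}` with the fan links `P_{2l−a}` — so the fan observable there is a configuration COUNT times a fixed unit complex number (the `k`-mark
analogue of Khristoforov–Smirnov's `F(z) ∈ [τ^{j−1}, τ^{j+1}]`, with one endpoint). [cite: KhristoforovSmirnov2021, §2 eq. (4) and Remark 6 (arXiv v1 p. 5)] -/
theorem gkW_fan_boundary {v : HexVertex} (hv : AllSides D v) {i : Fin 3} {s : HexVertex}
    (hs : s ∈ ({v, oppFace v i} : Finset HexVertex)) (hsc : s ∉ corners D) {g o : Site 2} (he : side v i = s(g, o))
    {a : Fin (2 * l + 1)} (hla : l ≤ a.val) (hd : (g, o) ∈ D.stretch a) {ξ : Finset (Sym2 (Site 2))} (hξ : ξ ∈ TXb D v i s) :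
    GkW (D := D) (fanWt l) v i s ξ =
      if InClassX D (faceVertex v (i + 1)) (faceVertex v (i + 2)) s ⟨2 * l - a.val, twoL_sub_lt a⟩ ξ ∧
          linkRel D ξ = fanRel l (2 * l - a.val) then -((-tau ^ 2) ^ (2 * l - a.val)) else 0 := by
  classical
  unfold GkW
  set m₀ : Fin (2 * l + 1) := ⟨2 * l - a.val, twoL_sub_lt a⟩ with hm₀
  have ha := a.isLt
  -- every other class carries weight zero
  have hzero : ∀ j : Fin (2 * l + 1), j ≠ m₀ → InClassX D (faceVertex v (i + 1)) (faceVertex v (i + 2)) s j ξ →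
      fanWt l j (linkRel D ξ) = 0 := by
    intro j hj hcl
    by_cases hjl : l < j.val
    · exact fanWt_eq_zero_of_lt hjl _
    · refine fanWt_eq_zero_of_boundary hv hs hsc he hd hξ hcl ⟨?_, ?_, ?_⟩
      · intro e; omega
      · intro e
        have ev : a.val = j.val := congrArg Fin.val e
        apply hj; rw [hm₀]; exact Fin.ext (show j.val = 2 * l - a.val by omega)
      · intro e; apply hj; rw [hm₀]; exact Fin.ext (show j.val = 2 * l - a.val by omega)
  rw [Finset.sum_eq_single m₀]
  · by_cases hc : InClassX D (faceVertex v (i + 1)) (faceVertex v (i + 2)) s m₀ ξ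
    · by_cases hL : linkRel D ξ = fanRel l (2 * l - a.val)
      · rw [if_pos hc, if_pos (And.intro hc hL)]
        exact fanWt_eq_of_eq (show m₀.val ≤ l by rw [hm₀]; show 2 * l - a.val ≤ l; omega) hL
      · have hc2 : ¬ (InClassX D (faceVertex v (i + 1)) (faceVertex v (i + 2)) s m₀ ξ ∧ linkRel D ξ = fanRel l (2 * l - a.val)) :=
          fun h => hL h.2
        rw [if_pos hc, if_neg hc2]
        by_contra hne
        exact hL (fanWt_ne_zero_iff hne).2
    · have hc2 : ¬ (InClassX D (faceVertex v (i + 1)) (faceVertex v (i + 2)) s m₀ ξ ∧ linkRel D ξ = fanRel l (2 * l - a.val)) :=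
        fun h => hc h.1
      rw [if_neg hc, if_neg hc2]
  · intro j _ hj
    by_cases hcl : InClassX D (faceVertex v (i + 1)) (faceVertex v (i + 2)) s j ξ
    · rw [if_pos hcl, hzero j hj hcl]
    · rw [if_neg hcl]
  · intro h; exact absurd (Finset.mem_univ _) h

open Classical in
/-- hence the fan observable at such a boundary mid-edge is the fixed phase times a natural number (the number of configurations, over both
halves of the edge, linking `z` to `u_{2l−a}` with the fan links). [cite: KhristoforovSmirnov2021, §2 eq. (4) and Remark 6 (arXiv v1 p. 5)] -/
theorem obsW_fan_boundary {v : HexVertex} (hv : AllSides D v) {i : Fin 3} (hvc : v ∉ corners D) (hoc : oppFace v i ∉ corners D)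
    {g o : Site 2} (he : side v i = s(g, o)) {a : Fin (2 * l + 1)} (hla : l ≤ a.val) (hd : (g, o) ∈ D.stretch a) :
    ∃ N : ℕ, ObsW D (fanWt l) v i = -((-tau ^ 2) ^ (2 * l - a.val)) * N := by
  classical
  have key : ∀ s ∈ ({v, oppFace v i} : Finset HexVertex), s ∉ corners D →
      ∃ N : ℕ, ∑ ξ ∈ TXb D v i s, GkW (D := D) (fanWt l) v i s ξ = -((-tau ^ 2) ^ (2 * l - a.val)) * N := by
    intro s hs hsc
    refine ⟨#((TXb D v i s).filter fun ξ => InClassX D (faceVertex v (i + 1)) (faceVertex v (i + 2)) s ⟨2 * l - a.val, twoL_sub_lt a⟩ ξ ∧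
      linkRel D ξ = fanRel l (2 * l - a.val)), ?_⟩
    rw [Finset.card_filter, Nat.cast_sum, Finset.mul_sum]
    refine Finset.sum_congr rfl fun ξ hξ => ?_
    rw [gkW_fan_boundary hv hs hsc he hla hd hξ]
    split_ifs <;> simp
  obtain ⟨N₁, h₁⟩ := key v (by simp) hvc
  obtain ⟨N₂, h₂⟩ := key (oppFace v i) (by simp) hoc
  refine ⟨N₁ + N₂, ?_⟩
  unfold ObsW
  rw [h₁, h₂]
  push_cast
  ring

end FanBoundary

section FanBoundaryTwo

variable {l : ℕ} {D : TriMarkedDomain (2 * l + 1)}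

/-- Auxiliary: `a + 1` as a mark index when `a < l`. [folklore] -/
private theorem succ_lt_of_lt {a : Fin (2 * l + 1)} (h : a.val < l) : a.val + 1 < 2 * l + 1 := by omega

open Classical in
/-- the `j`-th summand of the fan weight at an apex `j ≤ l`: the fan phase if the configuration is in class `j` with the fan links, else `0`.
[cite: KhristoforovSmirnov2021, §2 Definition 3 (arXiv v1 p. 4)] -/
private theorem summand_eq {v : HexVertex} {i : Fin 3} {s : HexVertex} {ξ : Finset (Sym2 (Site 2))} {j : Fin (2 * l + 1)} (hj : j.val ≤ l) :
    (if InClassX D (faceVertex v (i + 1)) (faceVertex v (i + 2)) s j ξ then fanWt l j (linkRel D ξ) else 0) =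
      if InClassX D (faceVertex v (i + 1)) (faceVertex v (i + 2)) s j ξ ∧ linkRel D ξ = fanRel l j.val then -((-tau ^ 2) ^ j.val) else 0 := by
  by_cases hc : InClassX D (faceVertex v (i + 1)) (faceVertex v (i + 2)) s j ξ
  · by_cases hL : linkRel D ξ = fanRel l j.val
    · rw [if_pos hc, if_pos (And.intro hc hL), fanWt_eq_of_eq hj hL]
    · have hc2 : ¬ (InClassX D (faceVertex v (i + 1)) (faceVertex v (i + 2)) s j ξ ∧ linkRel D ξ = fanRel l j.val) := fun h => hL h.2
      rw [if_pos hc, if_neg hc2]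
      by_contra hne
      exact hL (fanWt_ne_zero_iff hne).2
  · have hc2 : ¬ (InClassX D (faceVertex v (i + 1)) (faceVertex v (i + 2)) s j ξ ∧ linkRel D ξ = fanRel l j.val) := fun h => hc h.1
    rw [if_neg hc, if_neg hc2]

open Classical in
/-- ★★ **THE TWO-TERM BOUNDARY LAW OF THE FAN OBSERVABLE**: at a boundary mid-edge `z ∈ A_a` with `a < l` (the apex side of the fan),
every configuration weighs `0`, `−(−τ²)^a` (class `u_a` with the fan links `P_a`) or `−(−τ²)^{a+1}` (class `u_{a+1}` with `P_{a+1}`) —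
so the fan observable there is `−(−τ²)^a (N_a + (−τ²) N_{a+1})` with `N_a, N_{a+1} ∈ ℕ`: a value in a fixed sector of opening `π/3`
(the `k`-mark analogue of Khristoforov–Smirnov's `F(z) ∈ [τ^{j−1}, τ^{j+1}]`, eq. (4) p. 5). [cite: KhristoforovSmirnov2021, §2 eq. (4) and Remark 6 (arXiv v1 p. 5)] -/
theorem gkW_fan_boundary_two {v : HexVertex} (hv : AllSides D v) {i : Fin 3} {s : HexVertex}
    (hs : s ∈ ({v, oppFace v i} : Finset HexVertex)) (hsc : s ∉ corners D) {g o : Site 2} (he : side v i = s(g, o))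
    {a : Fin (2 * l + 1)} (hal : a.val < l) (hd : (g, o) ∈ D.stretch a) {ξ : Finset (Sym2 (Site 2))} (hξ : ξ ∈ TXb D v i s) :
    GkW (D := D) (fanWt l) v i s ξ =
      (if InClassX D (faceVertex v (i + 1)) (faceVertex v (i + 2)) s a ξ ∧ linkRel D ξ = fanRel l a.val
        then -((-tau ^ 2) ^ a.val) else 0) +
      (if InClassX D (faceVertex v (i + 1)) (faceVertex v (i + 2)) s ⟨a.val + 1, succ_lt_of_lt hal⟩ ξ ∧
          linkRel D ξ = fanRel l (a.val + 1) then -((-tau ^ 2) ^ (a.val + 1)) else 0) := by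
  unfold GkW
  set a₁ : Fin (2 * l + 1) := ⟨a.val + 1, succ_lt_of_lt hal⟩ with ha₁
  have ha := a.isLt
  have hne : a₁ ≠ a := fun e => by have := congrArg Fin.val e; rw [ha₁] at this; simp only at this; omega
  have hzero : ∀ j : Fin (2 * l + 1), j ≠ a → j ≠ a₁ →
      (if InClassX D (faceVertex v (i + 1)) (faceVertex v (i + 2)) s j ξ then fanWt l j (linkRel D ξ) else 0) = 0 := by
    intro j hj hj1
    by_cases hcl : InClassX D (faceVertex v (i + 1)) (faceVertex v (i + 2)) s j ξ
    · rw [if_pos hcl]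
      by_cases hjl : l < j.val
      · exact fanWt_eq_zero_of_lt hjl _
      · refine fanWt_eq_zero_of_boundary hv hs hsc he hd hξ hcl ⟨?_, ?_, ?_⟩
        · intro e; apply hj1; rw [ha₁]; exact Fin.ext (show j.val = a.val + 1 by omega)
        · intro e; exact hj e.symm
        · intro e; omega
    · rw [if_neg hcl]
  rw [← Finset.add_sum_erase _ _ (Finset.mem_univ a), Finset.sum_eq_single a₁]
  · rw [summand_eq (show a.val ≤ l by omega), summand_eq (show a₁.val ≤ l by rw [ha₁]; show a.val + 1 ≤ l; omega)]
  · intro j hj hj1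
    exact hzero j (Finset.ne_of_mem_erase hj) hj1
  · intro h
    exact absurd (Finset.mem_erase.2 ⟨hne, Finset.mem_univ _⟩) h

open Classical in
/-- hence, for `a < l`, the fan observable at such a boundary mid-edge is the TWO-TERM combination
`ObsW = −(−τ²)^a · (N_a + (−τ²)·N_{a+1})`, with `N_a`, `N_{a+1}` the numbers of configurations (over both halves of the edge) linking `z`
to `u_a`, `u_{a+1}` with the fan links. [cite: KhristoforovSmirnov2021, §2 eq. (4) and Remark 6 (arXiv v1 p. 5)] -/
theorem obsW_fan_boundary_two {v : HexVertex} (hv : AllSides D v) {i : Fin 3} (hvc : v ∉ corners D) (hoc : oppFace v i ∉ corners D)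
    {g o : Site 2} (he : side v i = s(g, o)) {a : Fin (2 * l + 1)} (hal : a.val < l) (hd : (g, o) ∈ D.stretch a) :
    ∃ Na Nb : ℕ, ObsW D (fanWt l) v i = -((-tau ^ 2) ^ a.val) * (Na + (-tau ^ 2) * Nb) := by
  classical
  have key : ∀ s ∈ ({v, oppFace v i} : Finset HexVertex), s ∉ corners D →
      ∃ Na Nb : ℕ, ∑ ξ ∈ TXb D v i s, GkW (D := D) (fanWt l) v i s ξ = -((-tau ^ 2) ^ a.val) * (Na + (-tau ^ 2) * Nb) := by
    intro s hs hsc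
    refine ⟨#((TXb D v i s).filter fun ξ => InClassX D (faceVertex v (i + 1)) (faceVertex v (i + 2)) s a ξ ∧
        linkRel D ξ = fanRel l a.val),
      #((TXb D v i s).filter fun ξ => InClassX D (faceVertex v (i + 1)) (faceVertex v (i + 2)) s ⟨a.val + 1, succ_lt_of_lt hal⟩ ξ ∧
        linkRel D ξ = fanRel l (a.val + 1)), ?_⟩
    rw [Finset.sum_congr rfl fun ξ hξ => gkW_fan_boundary_two hv hs hsc he hal hd hξ, Finset.sum_add_distrib,
      Finset.card_filter, Finset.card_filter, Nat.cast_sum, Nat.cast_sum, mul_add, Finset.mul_sum, ← mul_assoc, Finset.mul_sum]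
    congr 1
    · refine Finset.sum_congr rfl fun ξ _ => ?_
      split_ifs <;> push_cast <;> ring
    · refine Finset.sum_congr rfl fun ξ _ => ?_
      split_ifs <;> push_cast <;> ring
  obtain ⟨N₁, M₁, h₁⟩ := key v (by simp) hvc
  obtain ⟨N₂, M₂, h₂⟩ := key (oppFace v i) (by simp) hoc
  refine ⟨N₁ + N₂, M₁ + M₂, ?_⟩
  unfold ObsW
  rw [h₁, h₂]
  push_cast
  ring

end FanBoundaryTwo

end Literature.Probability.Percolation.MarkedLoops
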